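import Mathlib
import HarnessLib
import Literature.Analysis.Complex.LaplaceDecaySupport
import Literature.Analysis.Complex.GeneralDirichletSeriesFibres
import Summits.AtomisticToContinuum.Crystallization.Theorems.HolmgrenBoyleLindHalfSpaceUniqueContinuationShellLaplace

/-!
# Route `HolmgrenBoyleLind`: Lennard-Jones force fields of separated sources, part 13 —
the zero Fourier mode of a layer sum: Laplace form and uniqueness

Support file for the crux item stmt-AtomisticToContinuum-6075 (`HalfSpaceUniqueContinuation`, line
`registered`, layered core; infrastructure written by a stub-worker of lead c3). ABSTRACT SETTING
(no geometry): a countable family of sources `q` with weights `θ q ∈ ℂ`, `‖θ q‖ ≤ 1`, and heights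
`y q ≥ 0` with a uniform window count `N`. The zero in-plane Fourier mode of the vertical
Lennard-Jones force of an `L`-periodic layer at vertical distance `t` is `−π (t⁻⁵/3 − t⁻¹¹/6)`
(in-plane integrals `∫ (‖x‖² + t²)^{-4} dx = π/(3t⁶)`, `∫ (‖x‖² + t²)^{-7} dx = π/(6t¹²)`), so the
zero mode of the signed layer family observed at depth `X + t₀` is
`Z(X) = ∑_q θ q ((X + y_q + t₀)⁻⁵/3 − (X + y_q + t₀)⁻¹¹/6)`. The height fibres are finite by the
landed `hbl_shell_heights_finite` (sibling brick `…ShellLaplace`, the `k ≠ 0` analogue), re-exported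
as `hbl_zeroMode_heights_finite`. We prove:

* **`hbl_hasSum_zeroMode_eq_laplace`** — `Z(X) = ∫₀^∞ e^{-lX} ρ(l) dl` for `X > 0`, with the
  DENSITY `ρ(l) = (∑_q θ q e^{-l (y_q + t₀)}) · (l⁴/(3 Γ(5)) − l¹⁰/(6 Γ(11)))`, integrable and
  continuous on `(0, ∞)` (`t^{-ν} = Γ(ν)⁻¹ ∫₀^∞ l^{ν-1} e^{-lt} dl`, dominated convergence with the
  window-count majorant `∑_q e^{-l y_q} ≤ N/(1 − e^{-l})`);
* **`hbl_zeroMode_fibres_eq_zero`** — if `Z(X) = 0` for all `X ≥ X₁` then every height fibre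
  `∑_{q : y_q = η} θ q` vanishes (`Literature.Analysis.Complex.ae_eq_zero_of_laplace_exp_decay` for
  every `κ`, continuity, the polynomial factor is non-zero on `(0, 1)`, then
  `generalDirichlet_hasSum_zero_of_eqOn_Ioo` and `fibre_sum_eq_zero_of_generalDirichlet_hasSum_zero`).
The "density-neutrality of every defect layer" step of the peeling; `[folklore]`, closes no item.
-/

noncomputable section

namespace Summit.AtomisticToContinuum.Crystallization.Theorems.HolmgrenBoyleLind

open scoped BigOperators Topology Nat
open MeasureTheory Filter Set

section ZeroMode

variable {ι : Type*} [Countable ι] {θ : ι → ℂ} {y : ι → ℝ} {N : ℕ}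

/-- Finiteness of the height fibres `{q | y q ≤ Y}` below any bound (window count): the landed
`hbl_shell_heights_finite` of the sibling brick, under the name used by the registered stub.
[folklore] -/
alias hbl_zeroMode_heights_finite := hbl_shell_heights_finite

omit [Countable ι] in
/-- Window count: `q ↦ e^{-l y_q}` is summable with sum `≤ N / (1 - e^{-l})` for `l > 0` (at most
`N` sources have `⌊y_q⌋ = j`; geometric series). [folklore] -/
private theorem hbl_zm_summable_exp
    (hN : ∀ j : ℕ, {q : ι | (j : ℝ) ≤ y q ∧ y q ≤ j + 1}.encard ≤ N) (hy : ∀ q, 0 ≤ y q)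
    {l : ℝ} (hl : 0 < l) :
    Summable (fun q => Real.exp (-(l * y q))) ∧
      ∑' q, Real.exp (-(l * y q)) ≤ N / (1 - Real.exp (-l)) := by
  classical
  set r : ℝ := Real.exp (-l) with hr
  have hr0 : 0 ≤ r := (Real.exp_pos _).le
  have hgeom : HasSum (fun j : ℕ => r ^ j) (1 - r)⁻¹ :=
    hasSum_geometric_of_lt_one hr0 (Real.exp_lt_one_iff.2 (neg_lt_zero.2 hl))
  have hcard : ∀ (u : Finset ι) (j : ℕ), (u.filter fun q => ⌊y q⌋₊ = j).card ≤ N := fun u j => by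
    have hsub : ((u.filter fun q => ⌊y q⌋₊ = j : Finset ι) : Set ι) ⊆
        {q : ι | (j : ℝ) ≤ y q ∧ y q ≤ j + 1} := fun q hq => by
      rw [Finset.coe_filter] at hq
      obtain ⟨-, rfl⟩ := hq
      exact ⟨Nat.floor_le (hy q), (Nat.lt_floor_add_one (y q)).le⟩
    have h := (Set.encard_le_encard hsub).trans (hN j)
    rw [Set.encard_coe_eq_coe_finsetCard] at h
    exact_mod_cast h
  have hfin : ∀ u : Finset ι, ∑ q ∈ u, Real.exp (-(l * y q)) ≤ N / (1 - Real.exp (-l)) := by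
    intro u
    calc ∑ q ∈ u, Real.exp (-(l * y q)) ≤ ∑ q ∈ u, r ^ ⌊y q⌋₊ := by
          refine Finset.sum_le_sum fun q _ => ?_
          rw [hr, ← Real.exp_nat_mul, Real.exp_le_exp]
          nlinarith [Nat.floor_le (hy q)]
      _ = ∑ j ∈ u.image (fun q => ⌊y q⌋₊), ∑ q ∈ u with ⌊y q⌋₊ = j, r ^ ⌊y q⌋₊ :=
          (Finset.sum_fiberwise_of_maps_to (fun q hq => Finset.mem_image_of_mem _ hq) _).symm
      _ = ∑ j ∈ u.image (fun q => ⌊y q⌋₊), ((u.filter fun q => ⌊y q⌋₊ = j).card : ℝ) * r ^ j := by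
          refine Finset.sum_congr rfl fun j _ => ?_
          rw [Finset.sum_congr rfl fun q hq => by rw [(Finset.mem_filter.mp hq).2],
            Finset.sum_const, nsmul_eq_mul]
      _ ≤ ∑ j ∈ u.image (fun q => ⌊y q⌋₊), (N : ℝ) * r ^ j := by
          gcongr with j hj
          exact hcard u j
      _ ≤ N * (1 - r)⁻¹ := by
          rw [← Finset.mul_sum]
          exact mul_le_mul_of_nonneg_left
            (sum_le_hasSum _ (fun j _ => pow_nonneg hr0 j) hgeom) (Nat.cast_nonneg N)
      _ = N / (1 - r) := (div_eq_mul_inv _ _).symm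
  exact ⟨summable_of_sum_le (fun _ => (Real.exp_pos _).le) hfin,
    Real.tsum_le_of_sum_le (fun _ => (Real.exp_pos _).le) hfin⟩

/-- Termwise bound: `‖c e^{-(a + t₀) l}‖ ≤ e^{-l₀ a}` for `‖c‖ ≤ 1`, `a, t₀ ≥ 0`, `0 ≤ l₀ ≤ l`.
[folklore] -/
private theorem hbl_zm_norm_term_le {c : ℂ} (hc : ‖c‖ ≤ 1) {a t₀ l₀ l : ℝ} (ha : 0 ≤ a)
    (ht₀ : 0 ≤ t₀) (hl₀ : 0 ≤ l₀) (hl : l₀ ≤ l) :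
    ‖c * Complex.exp (-(((a + t₀) * l : ℝ) : ℂ))‖ ≤ Real.exp (-(l₀ * a)) := by
  rw [norm_mul, ← Complex.ofReal_neg, Complex.norm_exp_ofReal]
  refine (mul_le_of_le_one_left (Real.exp_pos _).le hc).trans (Real.exp_le_exp.2 ?_)
  nlinarith

/-- Norm of a term of the layer sum. [folklore] -/
private theorem hbl_zm_norm_term (c : ℂ) (a : ℝ) :
    ‖c * Complex.exp (-((a : ℝ) : ℂ))‖ = ‖c‖ * Real.exp (-a) := by
  rw [norm_mul, ← Complex.ofReal_neg, Complex.norm_exp_ofReal]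

omit [Countable ι] in
/-- The weighted layer sum `T(l) = ∑_q ‖θ q‖ e^{-(y_q + t₀) l}` is summable with
`T(l) ≤ e^{-t₀ l} N / (1 - e^{-l})` for `l > 0`. [folklore] -/
private theorem hbl_zm_summable_T (hθ : ∀ q, ‖θ q‖ ≤ 1) (hy : ∀ q, 0 ≤ y q)
    (hN : ∀ j : ℕ, {q : ι | (j : ℝ) ≤ y q ∧ y q ≤ j + 1}.encard ≤ N) (t₀ : ℝ)
    {l : ℝ} (hl : 0 < l) :
    Summable (fun q => ‖θ q‖ * Real.exp (-((y q + t₀) * l))) ∧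
      ∑' q, ‖θ q‖ * Real.exp (-((y q + t₀) * l)) ≤
        Real.exp (-(t₀ * l)) * (N / (1 - Real.exp (-l))) := by
  obtain ⟨hs, hle⟩ := hbl_zm_summable_exp hN hy hl
  have hterm : ∀ q, ‖θ q‖ * Real.exp (-((y q + t₀) * l)) ≤
      Real.exp (-(t₀ * l)) * Real.exp (-(l * y q)) := fun q => by
    rw [← Real.exp_add, show -(t₀ * l) + -(l * y q) = -((y q + t₀) * l) by ring]
    exact mul_le_of_le_one_left (Real.exp_pos _).le (hθ q)
  have hs' : Summable fun q => Real.exp (-(t₀ * l)) * Real.exp (-(l * y q)) := hs.mul_left _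
  have hsum : Summable fun q => ‖θ q‖ * Real.exp (-((y q + t₀) * l)) :=
    .of_nonneg_of_le (fun _ => by positivity) hterm hs'
  refine ⟨hsum, (hsum.tsum_le_tsum hterm hs').trans ?_⟩
  exact tsum_mul_left.trans_le (mul_le_mul_of_nonneg_left hle (Real.exp_pos _).le)

omit [Countable ι] in
/-- A series of continuous functions admitting, on every `[l₀, ∞)` with `l₀ > 0`, a summable
majorant is continuous on `(0, ∞)`. [folklore] -/
private theorem hbl_zm_continuousOn_tsum {E : Type*} [NormedAddCommGroup E] [CompleteSpace E]
    {g : ι → ℝ → E} (hg : ∀ q, Continuous (g q))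
    (hb : ∀ l₀ : ℝ, 0 < l₀ → ∃ u : ι → ℝ, Summable u ∧ ∀ q l, l₀ ≤ l → ‖g q l‖ ≤ u q) :
    ContinuousOn (fun l => ∑' q, g q l) (Ioi 0) := by
  intro l hl
  have hl' : (0 : ℝ) < l := hl
  obtain ⟨u, hu, hle⟩ := hb (l / 2) (half_pos hl')
  have h : ContinuousOn (fun l => ∑' q, g q l) (Ioi (l / 2)) :=
    continuousOn_tsum (fun q => (hg q).continuousOn) hu fun q x hx => hle q x (le_of_lt hx)
  exact (h.continuousAt (Ioi_mem_nhds (by linarith))).continuousWithinAt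

/-- `Γ(5) = 4! = 24` and `Γ(11) = 10! = 3628800`. [folklore] -/
private theorem hbl_zm_Gamma_values : Real.Gamma 5 = 24 ∧ Real.Gamma 11 = 3628800 := by
  rw [show (5 : ℝ) = (4 : ℕ) + 1 by norm_num, show (11 : ℝ) = (10 : ℕ) + 1 by norm_num,
    Real.Gamma_nat_eq_factorial, Real.Gamma_nat_eq_factorial]
  norm_num [Nat.factorial]

/-- `l ↦ l ^ n e^{-t l}` is integrable on `(0, ∞)` with integral `n! t^{-(n+1)}` (`t > 0`; Euler).
[folklore] -/
private theorem hbl_zm_pow_mul_exp (n : ℕ) {t : ℝ} (ht : 0 < t) :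
    IntegrableOn (fun l : ℝ => l ^ n * Real.exp (-(t * l))) (Ioi 0) ∧
      ∫ l in Ioi (0 : ℝ), l ^ n * Real.exp (-(t * l)) = t⁻¹ ^ (n + 1) * n ! := by
  constructor
  · have h := integrableOn_rpow_mul_exp_neg_mul_rpow (s := n) (p := 1)
      (neg_one_lt_zero.trans_le (Nat.cast_nonneg n)) le_rfl ht
    refine h.congr_fun (fun l _ => ?_) measurableSet_Ioi
    simp only [Real.rpow_natCast, Real.rpow_one, neg_mul]
  · have h := Real.integral_rpow_mul_exp_neg_mul_Ioi (a := (n : ℝ) + 1) (r := t) (by positivity) ht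
    simp_rw [add_sub_cancel_right, Real.rpow_natCast] at h
    rw [h, Real.Gamma_nat_eq_factorial, one_div, ← Nat.cast_succ, Real.rpow_natCast]

/-- The Laplace form of the zero-mode kernel: for `t > 0`,
`∫₀^∞ e^{-tl} (l⁴/(3Γ(5)) − l¹⁰/(6Γ(11))) dl = t⁻⁵/3 − t⁻¹¹/6`. [folklore] -/
private theorem hbl_zm_integral_kernel {t : ℝ} (ht : 0 < t) :
    ∫ l in Ioi (0 : ℝ), Real.exp (-(t * l)) *
        (l ^ 4 / (3 * Real.Gamma 5) - l ^ 10 / (6 * Real.Gamma 11)) =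
      t⁻¹ ^ 5 / 3 - t⁻¹ ^ 11 / 6 := by
  have heq : ∀ l : ℝ, Real.exp (-(t * l)) *
      (l ^ 4 / (3 * Real.Gamma 5) - l ^ 10 / (6 * Real.Gamma 11)) =
      (3 * Real.Gamma 5)⁻¹ * (l ^ 4 * Real.exp (-(t * l))) -
        (6 * Real.Gamma 11)⁻¹ * (l ^ 10 * Real.exp (-(t * l))) := fun l => by ring
  simp_rw [heq]
  rw [integral_sub ((hbl_zm_pow_mul_exp 4 ht).1.const_mul _)
    ((hbl_zm_pow_mul_exp 10 ht).1.const_mul _), integral_const_mul, integral_const_mul,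
    (hbl_zm_pow_mul_exp 4 ht).2, (hbl_zm_pow_mul_exp 10 ht).2, hbl_zm_Gamma_values.1,
    hbl_zm_Gamma_values.2]
  norm_num [Nat.factorial]
  ring

/-- The polynomial factor `l⁴/(3Γ(5)) − l¹⁰/(6Γ(11))` is positive on `(0, 1)`. [folklore] -/
private theorem hbl_zm_kernel_pos {l : ℝ} (h0 : 0 < l) (h1 : l < 1) :
    0 < l ^ 4 / (3 * Real.Gamma 5) - l ^ 10 / (6 * Real.Gamma 11) := by
  rw [hbl_zm_Gamma_values.1, hbl_zm_Gamma_values.2]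
  have h4 : 0 < l ^ 4 := by positivity
  nlinarith [mul_pos h4 (sub_pos.2 (pow_lt_one₀ h0.le h1 (by norm_num : (6 : ℕ) ≠ 0)))]

omit [Countable ι] in
/-- Domination: an integrable majorant on `(0, ∞)` for `T(l) · |l⁴/(3Γ5) − l¹⁰/(6Γ11)|`, using
`T(l) ≤ N e^{-t₀ l} (1 - e^{-l})⁻¹ ≤ N e^{-t₀ l} (1 + l⁻¹)`. [folklore] -/
private theorem hbl_zm_dominate (hθ : ∀ q, ‖θ q‖ ≤ 1) (hy : ∀ q, 0 ≤ y q)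
    (hN : ∀ j : ℕ, {q : ι | (j : ℝ) ≤ y q ∧ y q ≤ j + 1}.encard ≤ N) {t₀ : ℝ} (ht₀ : 0 < t₀) :
    ∃ g : ℝ → ℝ, IntegrableOn g (Ioi 0) ∧ ∀ l : ℝ, 0 < l →
      (∑' q, ‖θ q‖ * Real.exp (-((y q + t₀) * l))) *
          |l ^ 4 / (3 * Real.Gamma 5) - l ^ 10 / (6 * Real.Gamma 11)| ≤ g l := by
  refine ⟨fun l => (N : ℝ) * ((l ^ 4 * Real.exp (-(t₀ * l)) + l ^ 3 * Real.exp (-(t₀ * l))) +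
      (l ^ 10 * Real.exp (-(t₀ * l)) + l ^ 9 * Real.exp (-(t₀ * l)))), ?_, fun l hl => ?_⟩
  · exact (((hbl_zm_pow_mul_exp 4 ht₀).1.fun_add (hbl_zm_pow_mul_exp 3 ht₀).1).fun_add
      ((hbl_zm_pow_mul_exp 10 ht₀).1.fun_add (hbl_zm_pow_mul_exp 9 ht₀).1)).const_mul (N : ℝ)
  · -- `(1 - e^{-l})⁻¹ ≤ 1 + l⁻¹`, from `1 + l ≤ e^l`
    have h5 : 0 < 1 - Real.exp (-l) := by
      linarith [Real.exp_lt_one_iff.2 (neg_lt_zero.2 hl)]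
    have hinv : (1 - Real.exp (-l))⁻¹ ≤ 1 + l⁻¹ := by
      have h4 : Real.exp (-l) ≤ (l + 1)⁻¹ := by
        rw [Real.exp_neg]
        exact inv_anti₀ (by positivity) (Real.add_one_le_exp l)
      rw [inv_le_comm₀ h5 (by positivity), show (1 + l⁻¹)⁻¹ = 1 - (l + 1)⁻¹ by field_simp; ring]
      linarith
    have hT : ∑' q, ‖θ q‖ * Real.exp (-((y q + t₀) * l)) ≤
        Real.exp (-(t₀ * l)) * (N * (1 + l⁻¹)) := by
      refine (hbl_zm_summable_T hθ hy hN t₀ hl).2.trans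
        (mul_le_mul_of_nonneg_left ?_ (Real.exp_pos _).le)
      rw [div_eq_mul_inv]
      exact mul_le_mul_of_nonneg_left hinv (Nat.cast_nonneg N)
    have hP : |l ^ 4 / (3 * Real.Gamma 5) - l ^ 10 / (6 * Real.Gamma 11)| ≤ l ^ 4 + l ^ 10 := by
      rw [hbl_zm_Gamma_values.1, hbl_zm_Gamma_values.2]
      refine (abs_sub _ _).trans ?_
      rw [abs_of_nonneg (by positivity), abs_of_nonneg (by positivity)]
      nlinarith [pow_pos hl 4, pow_pos hl 10]
    have hl0 : l ≠ 0 := hl.ne'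
    refine (mul_le_mul hT hP (abs_nonneg _) (by positivity)).trans_eq ?_
    field_simp

omit [Countable ι] in
/-- The zero-mode density `ρ(l) = (∑_q θ q e^{-l(y_q + t₀)}) (l⁴/(3Γ(5)) − l¹⁰/(6Γ(11)))` is
integrable on `(0, ∞)` and continuous there (`t₀ > 0`). [folklore] -/
theorem hbl_zeroModeDensity_integrable (hθ : ∀ q, ‖θ q‖ ≤ 1) (hy : ∀ q, 0 ≤ y q)
    (hN : ∀ j : ℕ, {q : ι | (j : ℝ) ≤ y q ∧ y q ≤ j + 1}.encard ≤ N) {t₀ : ℝ} (ht₀ : 0 < t₀) :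
    IntegrableOn (fun l : ℝ => (∑' q, θ q * Complex.exp (-(((y q + t₀) * l : ℝ) : ℂ))) *
        (((l ^ 4 / (3 * Real.Gamma 5) - l ^ 10 / (6 * Real.Gamma 11) : ℝ)) : ℂ)) (Ioi 0) ∧
      ContinuousOn (fun l : ℝ => (∑' q, θ q * Complex.exp (-(((y q + t₀) * l : ℝ) : ℂ))) *
        (((l ^ 4 / (3 * Real.Gamma 5) - l ^ 10 / (6 * Real.Gamma 11) : ℝ)) : ℂ)) (Ioi 0) := by
  have hS_cont : ContinuousOn
      (fun l : ℝ => ∑' q, θ q * Complex.exp (-(((y q + t₀) * l : ℝ) : ℂ))) (Ioi 0) :=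
    hbl_zm_continuousOn_tsum (fun q => by fun_prop) fun l₀ hl₀ =>
      ⟨_, (hbl_zm_summable_exp hN hy hl₀).1, fun q l hl =>
        hbl_zm_norm_term_le (hθ q) (hy q) ht₀.le hl₀.le hl⟩
  have hcont := hS_cont.mul (Continuous.continuousOn (s := Ioi 0) (by fun_prop : Continuous
    fun l : ℝ => (((l ^ 4 / (3 * Real.Gamma 5) - l ^ 10 / (6 * Real.Gamma 11) : ℝ)) : ℂ)))
  refine ⟨?_, hcont⟩
  obtain ⟨g, hgi, hg⟩ := hbl_zm_dominate hθ hy hN ht₀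
  refine Integrable.mono' hgi (hcont.aestronglyMeasurable measurableSet_Ioi) ?_
  rw [ae_restrict_iff' measurableSet_Ioi]
  refine Eventually.of_forall fun l (hl : 0 < l) => le_trans ?_ (hg l hl)
  rw [norm_mul, Complex.norm_real, Real.norm_eq_abs]
  refine mul_le_mul_of_nonneg_right ((norm_tsum_le_tsum_norm ?_).trans_eq
    (tsum_congr fun q => hbl_zm_norm_term _ _)) (abs_nonneg _)
  simpa only [hbl_zm_norm_term] using (hbl_zm_summable_T hθ hy hN t₀ hl).1

/-- Pointwise form of the `q`-th Laplace integrand. [folklore] -/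
private theorem hbl_zm_term_eq (c : ℂ) (X a l p : ℝ) :
    Complex.exp (-((l * X : ℝ) : ℂ)) * (c * Complex.exp (-((a * l : ℝ) : ℂ)) * (p : ℂ)) =
      c * (((Real.exp (-((X + a) * l)) * p : ℝ)) : ℂ) := by
  rw [show Real.exp (-((X + a) * l)) = Real.exp (-(l * X)) * Real.exp (-(a * l)) by
    rw [← Real.exp_add]; ring_nf]
  push_cast
  ring

/-- **The zero mode as a Laplace transform.** For `X > 0`, `t₀ > 0`:
`∑_q θ q ((X + y_q + t₀)⁻⁵/3 − (X + y_q + t₀)⁻¹¹/6) = ∫₀^∞ e^{-lX} ρ(l) dl`, the left side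
converging absolutely. [folklore] -/
theorem hbl_hasSum_zeroMode_eq_laplace (hθ : ∀ q, ‖θ q‖ ≤ 1) (hy : ∀ q, 0 ≤ y q)
    (hN : ∀ j : ℕ, {q : ι | (j : ℝ) ≤ y q ∧ y q ≤ j + 1}.encard ≤ N) {t₀ : ℝ} (ht₀ : 0 < t₀)
    {X : ℝ} (hX : 0 < X) :
    HasSum (fun q => θ q *
        ((((X + y q + t₀)⁻¹ ^ 5 / 3 - (X + y q + t₀)⁻¹ ^ 11 / 6 : ℝ)) : ℂ))
      (∫ l in Ioi (0 : ℝ), Complex.exp (-((l * X : ℝ) : ℂ)) *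
        ((∑' q, θ q * Complex.exp (-(((y q + t₀) * l : ℝ) : ℂ))) *
          (((l ^ 4 / (3 * Real.Gamma 5) - l ^ 10 / (6 * Real.Gamma 11) : ℝ)) : ℂ))) := by
  obtain ⟨g, hgi, hg⟩ := hbl_zm_dominate hθ hy hN ht₀
  -- each term is the Laplace transform of its share of the density; then dominated convergence
  have hFq : ∀ q, θ q * ((((X + y q + t₀)⁻¹ ^ 5 / 3 - (X + y q + t₀)⁻¹ ^ 11 / 6 : ℝ)) : ℂ) =
      ∫ l in Ioi (0 : ℝ), Complex.exp (-((l * X : ℝ) : ℂ)) *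
        (θ q * Complex.exp (-(((y q + t₀) * l : ℝ) : ℂ)) *
          (((l ^ 4 / (3 * Real.Gamma 5) - l ^ 10 / (6 * Real.Gamma 11) : ℝ)) : ℂ)) := by
    intro q
    have ht : 0 < X + (y q + t₀) := by linarith [hy q]
    rw [add_assoc, ← hbl_zm_integral_kernel ht, ← integral_complex_ofReal, ← integral_const_mul]
    exact setIntegral_congr_fun measurableSet_Ioi fun l _ =>
      (hbl_zm_term_eq (θ q) X (y q + t₀) l _).symm
  simp_rw [hFq]
  refine hasSum_integral_of_dominated_convergence
    (fun q l => Real.exp (-(l * X)) * (‖θ q‖ * Real.exp (-((y q + t₀) * l)) *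
      |l ^ 4 / (3 * Real.Gamma 5) - l ^ 10 / (6 * Real.Gamma 11)|))
    (fun q => Continuous.aestronglyMeasurable (by fun_prop))
    (fun q => Eventually.of_forall fun l => le_of_eq ?_) ?_ ?_ ?_
  · rw [norm_mul, norm_mul, hbl_zm_norm_term, ← Complex.ofReal_neg, Complex.norm_exp_ofReal,
      Complex.norm_real, Real.norm_eq_abs]
  · rw [ae_restrict_iff' measurableSet_Ioi]
    exact Eventually.of_forall fun l (hl : 0 < l) =>
      ((hbl_zm_summable_T hθ hy hN t₀ hl).1.mul_right _).mul_left _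
  · have hT : ContinuousOn (fun l : ℝ => ∑' q, ‖θ q‖ * Real.exp (-((y q + t₀) * l))) (Ioi 0) := by
      refine hbl_zm_continuousOn_tsum (fun q => by fun_prop) fun l₀ hl₀ =>
        ⟨_, (hbl_zm_summable_exp hN hy hl₀).1, fun q l hl => ?_⟩
      rw [Real.norm_of_nonneg (by positivity), ← hbl_zm_norm_term]
      exact hbl_zm_norm_term_le (hθ q) (hy q) ht₀.le hl₀.le hl
    simp_rw [tsum_mul_left, tsum_mul_right]
    refine Integrable.mono' hgi (((Continuous.continuousOn (by fun_prop)).mul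
      (hT.mul (Continuous.continuousOn (by fun_prop)))).aestronglyMeasurable measurableSet_Ioi) ?_
    rw [ae_restrict_iff' measurableSet_Ioi]
    refine Eventually.of_forall fun l (hl : 0 < l) => le_trans ?_ (hg l hl)
    rw [Real.norm_of_nonneg (by positivity)]
    exact mul_le_of_le_one_left (by positivity) (Real.exp_le_one_iff.2 (by nlinarith))
  · rw [ae_restrict_iff' measurableSet_Ioi]
    refine Eventually.of_forall fun l (hl : 0 < l) => ?_
    have hs : Summable fun q => θ q * Complex.exp (-(((y q + t₀) * l : ℝ) : ℂ)) :=
      .of_norm_bounded (hbl_zm_summable_exp hN hy hl).1 fun q =>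
        hbl_zm_norm_term_le (hθ q) (hy q) ht₀.le hl.le le_rfl
    exact (hs.hasSum.mul_right _).mul_left _

/-- **Uniqueness for the zero mode.** If the zero mode vanishes at all large depths,
`∑_q θ q ((X + y_q + t₀)⁻⁵/3 − (X + y_q + t₀)⁻¹¹/6) = 0` for all `X ≥ X₁` (`X₁ > 0`), then every
height fibre `∑_{q : y_q = η} θ q` vanishes (the registered stub, stated verbatim). [folklore] -/
theorem hbl_zeroMode_fibres_eq_zero : ∀ {ι : Type} [Countable ι] {θ : ι → ℂ} {y : ι → ℝ} {N : ℕ} (hθ : ∀ q, ‖θ q‖ ≤ 1) (hy : ∀ q, 0 ≤ y q) (hN : ∀ j : ℕ, {q : ι | (j : ℝ) ≤ y q ∧ y q ≤ j + 1}.encard ≤ N) {t₀ : ℝ}, 0 < t₀ → ∀ {X₁ : ℝ}, 0 < X₁ → (∀ X : ℝ, X₁ ≤ X → (∑' q, θ q * ((((X + y q + t₀)⁻¹ ^ 5 / 3 - (X + y q + t₀)⁻¹ ^ 11 / 6 : ℝ)) : ℂ)) = 0) → ∀ η : ℝ, ∑ q ∈ (Summit.AtomisticToContinuum.Crystallization.Theorems.HolmgrenBoyleLind.hbl_zeroMode_heights_finite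 hN hy η).toFinset with y q = η, θ q = 0 := by
  intro ι _ θ y N hθ hy hN t₀ ht₀ X₁ hX₁ hzero η
  obtain ⟨hint, hcont⟩ := hbl_zeroModeDensity_integrable hθ hy hN ht₀
  -- the Laplace transform of `ρ` vanishes for `X ≥ X₁`
  have hG : ∀ X : ℝ, X₁ ≤ X → (∫ l in Ioi (0 : ℝ), Complex.exp (-((l * X : ℝ) : ℂ)) *
      ((∑' q, θ q * Complex.exp (-(((y q + t₀) * l : ℝ) : ℂ))) *
        (((l ^ 4 / (3 * Real.Gamma 5) - l ^ 10 / (6 * Real.Gamma 11) : ℝ)) : ℂ))) = 0 := by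
    intro X hX
    rw [← (hbl_hasSum_zeroMode_eq_laplace hθ hy hN ht₀ (hX₁.trans_le hX)).tsum_eq]
    exact hzero X hX
  set ρ : ℝ → ℂ := fun l : ℝ => (∑' q, θ q * Complex.exp (-(((y q + t₀) * l : ℝ) : ℂ))) *
    (((l ^ 4 / (3 * Real.Gamma 5) - l ^ 10 / (6 * Real.Gamma 11) : ℝ)) : ℂ) with hρ
  -- `m = 1_{(0,∞)} ρ` vanishes a.e. (Pólya's theorem for every `κ = n + 1`), so `ρ ≡ 0` on `(0, ∞)`
  -- by continuity; the kernel is `> 0` on `(0, 1)`, then Dirichlet-series uniqueness for `y q + t₀`.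
  set m : ℝ → ℂ := (Ioi (0 : ℝ)).indicator ρ with hm
  have hm_int : Integrable m := (integrable_indicator_iff measurableSet_Ioi).2 hint
  have hm_supp : ∀ᵐ t ∂volume, t < 0 → m t = 0 := Eventually.of_forall fun t ht =>
    Set.indicator_of_notMem (fun h : t ∈ Ioi (0 : ℝ) => (lt_asymm h ht).elim) _
  have hm_lap : ∀ κ X : ℝ, X₁ ≤ X →
      ‖∫ t : ℝ, Complex.exp (-(t : ℂ) * X) * m t‖ ≤ 0 * Real.exp (-κ * X) := by
    intro κ X hX
    have h1 : ∫ t : ℝ, Complex.exp (-(t : ℂ) * X) * m t =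
        ∫ t in Ioi (0 : ℝ), Complex.exp (-((t * X : ℝ) : ℂ)) *
          ((∑' q, θ q * Complex.exp (-(((y q + t₀) * t : ℝ) : ℂ))) *
            (((t ^ 4 / (3 * Real.Gamma 5) - t ^ 10 / (6 * Real.Gamma 11) : ℝ)) : ℂ)) := by
      rw [← integral_indicator measurableSet_Ioi]
      refine integral_congr_ae (Eventually.of_forall fun t => ?_)
      show Complex.exp (-(t : ℂ) * X) * m t =
        (Ioi (0 : ℝ)).indicator (fun t => Complex.exp (-((t * X : ℝ) : ℂ)) * ρ t) t
      rw [Set.indicator_mul_right, Complex.ofReal_mul, neg_mul]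
    rw [h1, hG X hX, norm_zero, zero_mul]
  have hae : ∀ᵐ t ∂volume, m t = 0 := by
    have h : ∀ n : ℕ, ∀ᵐ t ∂volume, t < (n : ℝ) + 1 → m t = 0 := fun n =>
      Literature.Analysis.Complex.ae_eq_zero_of_laplace_exp_decay hm_int hm_supp
        (by positivity) (hm_lap ((n : ℝ) + 1))
    filter_upwards [ae_all_iff.2 h] with t ht
    exact ht ⌈t⌉₊ ((Nat.le_ceil t).trans_lt (lt_add_one _))
  have hρ0 : EqOn ρ 0 (Ioi 0) := by
    refine Measure.eqOn_open_of_ae_eq (μ := volume) ?_ isOpen_Ioi hcont continuousOn_const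
    rw [EventuallyEq, ae_restrict_iff' measurableSet_Ioi]
    filter_upwards [hae] with t ht hmem
    rwa [hm, Set.indicator_of_mem hmem] at ht
  have hsum : Summable fun q => ‖θ q‖ * Real.exp (-(1 / 4 * (y q + t₀))) :=
    (hbl_zm_summable_T hθ hy hN t₀ (by norm_num : (0 : ℝ) < 1 / 4)).1.congr fun q => by ring_nf
  have hS0 : ∀ s : ℝ, s ∈ Set.Ioo (1 / 2 : ℝ) 1 →
      HasSum (fun q => θ q * Complex.exp (-(((y q + t₀ : ℝ) : ℂ) * s))) 0 := by
    intro s hs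
    have hs0 : 0 < s := by linarith [hs.1]
    have hsm : Summable fun q => θ q * Complex.exp (-(((y q + t₀) * s : ℝ) : ℂ)) :=
      .of_norm_bounded (hbl_zm_summable_exp hN hy hs0).1 fun q =>
        hbl_zm_norm_term_le (hθ q) (hy q) ht₀.le hs0.le le_rfl
    have hval : ∑' q, θ q * Complex.exp (-(((y q + t₀) * s : ℝ) : ℂ)) = 0 := by
      have h := hρ0 (show s ∈ Ioi (0 : ℝ) from hs0)
      simp only [hρ, Pi.zero_apply, mul_eq_zero, Complex.ofReal_eq_zero] at h
      exact h.resolve_right (hbl_zm_kernel_pos hs0 hs.2).ne'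
    have hfun : ∀ q, θ q * Complex.exp (-(((y q + t₀ : ℝ) : ℂ) * s)) =
        θ q * Complex.exp (-(((y q + t₀) * s : ℝ) : ℂ)) := fun q => by push_cast; ring_nf
    simp_rw [hfun]
    exact hval ▸ hsm.hasSum
  have hall := Literature.Analysis.Complex.generalDirichlet_hasSum_zero_of_eqOn_Ioo
    (y := fun q => y q + t₀) (fun q => by linarith [hy q]) hsum
    (by norm_num : (1 / 4 : ℝ) < 1 / 2) (by norm_num) hS0
  have hfin' : ∀ Y : ℝ, {q : ι | y q + t₀ ≤ Y}.Finite := fun Y =>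
    (hbl_zeroMode_heights_finite hN hy (Y - t₀)).subset fun q (hq : y q + t₀ ≤ Y) => by
      show y q ≤ Y - t₀; linarith
  have hfib := Literature.Analysis.Complex.fibre_sum_eq_zero_of_generalDirichlet_hasSum_zero
    hfin' le_rfl hsum hall (η + t₀)
  have hF : ((hfin' (η + t₀)).toFinset.filter fun i => y i + t₀ = η + t₀) =
      ((hbl_zeroMode_heights_finite hN hy η).toFinset.filter fun q => y q = η) := by
    ext q
    simp only [Finset.mem_filter, Set.Finite.mem_toFinset, Set.mem_setOf_eq,
      add_le_add_iff_right, add_left_inj]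
  rw [← hF]
  exact hfib

end ZeroMode

end Summit.AtomisticToContinuum.Crystallization.Theorems.HolmgrenBoyleLind

end
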